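import Summits.FinalStateConjecture.FinalStateConjecture.Theorems.EIHFluxBalanceInertialRecessionRechartHover
import Summits.FinalStateConjecture.FinalStateConjecture.Theorems.EIHFluxBalanceInertialRecessionRechartOfut
import Summits.FinalStateConjecture.FinalStateConjecture.Theorems.EIHFluxBalanceInertialRecessionRechartKO

/-!
# Route EIHFluxBalance — `InertialRecession`, re-charting: reaching a tilted hole slab along the
# orbits of a FLOW (certified Killing-type orbits for rotating holes)

Helper file for the crux `stmt-FinalStateConjecture-10166`
(`Summit.FinalStateConjecture.FinalStateConjecture.Theses.EIHFluxBalance.InertialRecession`),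
stub `stub_rechart` (the transfer P2 of line `sublinear-is-free-clean-window-charges`).

`…RechartHover.mem_causalPast_image_truncTimeSlab_of_orbit` carries a model point to the certified
tilted slab `ψ({t* = τ₁, r ≤ R(τ₁)})` along the STRAIGHT static orbit `σ ↦ y + σu` of a boosted
Schwarzschild background. Inside the ergoregion of a rotating hole `∂_{t*}` is spacelike; the
certified direction there is the Carter field `χ = ∂_{t*} + a/(r² + a²)∂_φ` (`…StubRechart3Carter`),
whose orbits are HELICES at constant Kerr–Schild radius raising `t*` at unit rate. This file is the
flow version of the orbit lemma, for an abstract flow `F : E4 → ℝ → E4` on a reference background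
`Kb` (smooth in the flow parameter, `F y 0 = y`, tangent to a field `u`, mapping `Kb.domain` into
itself, raising `Kb.time` at unit rate, preserving `Kb.radius` — for boosted Kerr,
`F y σ = c + Λ(carterFlow a (Λ⁻¹(y − c)) σ)`, `u y = Λ χ(Λ⁻¹(y − c))`):
* `velocity_comp_flow` — `d(ψ ∘ F y)(σ)(1) = dψ(F y σ)(u(F y σ))`;
* `mem_causalPast_image_truncTimeSlab_of_flow` — if `dψ(u)` is future-directed on the certified zone
  `{S₀ ≤ t*, r₁ ≤ r ≤ R(t*)}` (`R` monotone), every such point `y` with `t*(y) ≤ τ₁` lies in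
  `J⁻(ψ({t* = τ₁, r ≤ R(τ₁)}))`;
* `isFutureDirected_mfderiv_flow_of_deviation` — the certification of `dψ(u)` for a re-charted
  chart `ψ = Φ ∘ A` from a model bound `Kb(u, u) ≤ −m`, `C⁰` deviation `≤ c` with `c‖u‖² < m`,
  lab-time raising `(DA·u)⁰ > 0` and (Ofut) (pointwise form of `…RechartKO`).
[O'Neill 1983, Ch. 14; Carter 1968; folklore causal bookkeeping]
-/

noncomputable section

set_option linter.dupNamespace false

open Set Filter Topology Function TopologicalSpace Literature.Geometry.Lorentzian
open scoped Manifold ContDiff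

namespace Summit.FinalStateConjecture.FinalStateConjecture.Theorems

/-! ### Orbits of a flow on a reference background -/

section Flow

variable {𝓢 : Spacetime 4} (Kb : ModelBackground) (F : E4 → ℝ → E4) (u : E4 → E4)
  (hF : ∀ y : E4, ContDiff ℝ ∞ (F y)) (hFu : ∀ (y : E4) (σ : ℝ), HasDerivAt (F y) (u (F y σ)) σ)
  (hF0 : ∀ y : E4, F y 0 = y)
  (hdom : ∀ y : E4, y ∈ Kb.domain → ∀ σ : ℝ, F y σ ∈ Kb.domain)
  (htime : ∀ (y : E4) (σ : ℝ), Kb.time (F y σ) = Kb.time y + σ)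
  (hrad : ∀ (y : E4) (σ : ℝ), Kb.radius (F y σ) = Kb.radius y)
  (ψ : Kb.domain → 𝓢.carrier) (hψ : ContMDiff 𝓘(ℝ, E4) (𝓡 4) ∞ ψ)

include hF hFu hdom hψ in
/-- **Velocity of the chart image of a flow orbit**: `d(ψ ∘ F y)(σ)(1) = dψ(F y σ)(u(F y σ))`.
[folklore] -/
theorem velocity_comp_flow (y : Kb.domain) (σ : ℝ) :
    MDifferentiableAt 𝓘(ℝ, ℝ) (𝓡 4) (fun s : ℝ ↦ ψ ⟨F y.1 s, hdom y.1 y.2 s⟩) σ ∧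
      velocity (𝓡 4) (fun s : ℝ ↦ ψ ⟨F y.1 s, hdom y.1 y.2 s⟩) σ =
        mfderiv 𝓘(ℝ, E4) (𝓡 4) ψ ⟨F y.1 σ, hdom y.1 y.2 σ⟩ (u (F y.1 σ)) :=
  velocity_comp_smooth_curve hψ (hF y.1) (hdom y.1 y.2) (hFu y.1 σ)

include hF hFu hF0 hdom htime hrad hψ in
/-- **Flow orbits reach the tilted slab.** If `dψ(u)` is future-directed at every point of
`Kb.domain` with `S₀ ≤ t*`, `r₁ ≤ r` and `r ≤ R(t*)` (`R` monotone), then every such point `y` with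
`t*(y) ≤ τ₁` lies in `J⁻(ψ({t* = τ₁, r ≤ R(τ₁)}))`: follow the orbit `σ ↦ ψ(F y σ)` for
`σ ∈ [0, τ₁ − t*(y)]`. [folklore] -/
theorem mem_causalPast_image_truncTimeSlab_of_flow (R : ℝ → ℝ) (hRm : Monotone R) {r₁ S₀ : ℝ}
    (hKO : ∀ z : Kb.domain, S₀ ≤ Kb.time z.1 → r₁ ≤ Kb.radius z.1 →
      Kb.radius z.1 ≤ R (Kb.time z.1) →
        𝓢.timeOrientation.IsFutureDirected (mfderiv 𝓘(ℝ, E4) (𝓡 4) ψ z (u z.1)))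
    (y : Kb.domain) (hyS : S₀ ≤ Kb.time y.1) (hyr : r₁ ≤ Kb.radius y.1)
    (hyR : Kb.radius y.1 ≤ R (Kb.time y.1)) {τ₁ : ℝ} (hy₁ : Kb.time y.1 ≤ τ₁) :
    ψ y ∈ 𝓢.metric.causalPast 𝓢.timeOrientation (ψ '' Kb.truncTimeSlab (R τ₁) τ₁) := by
  set L : ℝ := τ₁ - Kb.time y.1 with hL
  have hL0 : 0 ≤ L := by rw [hL]; linarith
  set γ : ℝ → 𝓢.carrier := fun s ↦ ψ ⟨F y.1 s, hdom y.1 y.2 s⟩ with hγ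
  have hγ0 : γ 0 = ψ y := by
    simp only [hγ, hF0]
  have hcurve : 𝓢.metric.IsFutureCausalCurveOn 𝓢.timeOrientation γ (Icc 0 L) := by
    intro s hs
    obtain ⟨hd, hv⟩ := velocity_comp_flow Kb F u hF hFu hdom ψ hψ y s
    refine ⟨hd, ?_⟩
    rw [hv]
    refine hKO _ ?_ ?_ ?_
    · show S₀ ≤ Kb.time (F y.1 s)
      rw [htime]; linarith [hs.1]
    · show r₁ ≤ Kb.radius (F y.1 s)
      rw [hrad]; exact hyr
    · show Kb.radius (F y.1 s) ≤ R (Kb.time (F y.1 s))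
      rw [hrad, htime]
      exact hyR.trans (hRm (by linarith [hs.1]))
  have hend : γ L ∈ ψ '' Kb.truncTimeSlab (R τ₁) τ₁ := by
    refine ⟨⟨F y.1 L, hdom y.1 y.2 L⟩, ?_, rfl⟩
    rw [ModelBackground.mem_truncTimeSlab]
    refine ⟨?_, ?_⟩
    · show Kb.time (F y.1 L) = τ₁
      rw [htime, hL]; ring
    · show Kb.radius (F y.1 L) ≤ R τ₁
      rw [hrad]; exact hyR.trans (hRm hy₁)
  rw [← hγ0]
  exact mem_causalPast_of_curve hcurve ⟨hL0, le_rfl⟩ hend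

include hF hFu hF0 hdom htime hrad hψ in
/-- **A certified reach time.** If the certification of `dψ(u)` holds after some model time `S₀`
on `{r₁ ≤ r ≤ R(t*)}`, then after `S₀` every such point with `t* ≤ τ₁` reaches the tilted slab at
`τ₁` — the form consumed by the transfer `exterior_subset_certified_union_causalPast₂` (its
hypothesis `hstat`). [folklore] -/
theorem flow_reach_of_certified (R : ℝ → ℝ) (hRm : Monotone R) {r₁ S₀ : ℝ}
    (hKO : ∀ z : Kb.domain, S₀ ≤ Kb.time z.1 → r₁ ≤ Kb.radius z.1 →
      Kb.radius z.1 ≤ R (Kb.time z.1) →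
        𝓢.timeOrientation.IsFutureDirected (mfderiv 𝓘(ℝ, E4) (𝓡 4) ψ z (u z.1))) :
    ∀ (y : Kb.domain) (τ₁ : ℝ), S₀ ≤ Kb.time y.1 → Kb.time y.1 ≤ τ₁ → r₁ ≤ Kb.radius y.1 →
      Kb.radius y.1 ≤ R (Kb.time y.1) →
        ψ y ∈ 𝓢.metric.causalPast 𝓢.timeOrientation (ψ '' Kb.truncTimeSlab (R τ₁) τ₁) :=
  fun y _ hyS hy₁ hyr hyR ↦ mem_causalPast_image_truncTimeSlab_of_flow Kb F u hF hFu hF0 hdom htime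
    hrad ψ hψ R hRm hKO y hyS hyr hyR hy₁

end Flow

/-! ### Certifying the flow direction for a re-charted chart -/

section Certify

variable {𝓢 : Spacetime 4} (Kb : ModelBackground) (U : Opens E4) (Φ : U → 𝓢.carrier)
  (hΦ : ContMDiff 𝓘(ℝ, E4) (𝓡 4) ∞ Φ) {A : E4 → E4} (hA : ContDiff ℝ ∞ A)
  (hAU : ∀ x ∈ Kb.domain, A x ∈ U)

include hΦ hA in
/-- **Certified flow direction of a re-charted chart, pointwise.** At a model point `y` with a
direction `w` of model value `Kb(y)(w, w) ≤ −m`, `C⁰` deviation of `(Φ ∘ A)^*g` from `Kb` at `y` at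
most `c` with `c‖w‖² < m`, lab-time raising `(DA(y)w)⁰ > 0` and (Ofut) at the lab point `A y`, the
push-forward `d(Φ ∘ A)(y)w` is future-directed. (The pointwise content of
`isFutureDirected_mfderiv_comp_of_deviation`; apply with `w = u y` the flow field.) [folklore] -/
theorem isFutureDirected_mfderiv_flow_of_deviation (Q : U → Prop)
    (hOfut : ∀ x : U, Q x → ∀ w : E4, 0 < w 0 →
      𝓢.metric.val (Φ x) (mfderiv 𝓘(ℝ, E4) (𝓡 4) Φ x w) (mfderiv 𝓘(ℝ, E4) (𝓡 4) Φ x w) < 0 →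
        𝓢.timeOrientation.IsFutureDirected (mfderiv 𝓘(ℝ, E4) (𝓡 4) Φ x w))
    (u : E4 → E4) (y : Kb.domain) (hQ : Q ⟨A y.1, hAU y.1 y.2⟩) (hA0 : 0 < (fderiv ℝ A y.1 (u y.1)) 0)
    {m c : ℝ} (hbil : Kb.bilin y.1 (u y.1) (u y.1) ≤ -m) (hc : c * ‖u y.1‖ ^ 2 < m)
    (hdev : ‖𝓢.deviation Kb (fun y : Kb.domain ↦ Φ ⟨A y.1, hAU y.1 y.2⟩) y‖ ≤ c) :
    𝓢.timeOrientation.IsFutureDirected (mfderiv 𝓘(ℝ, E4) (𝓡 4)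
      (fun y : Kb.domain ↦ Φ ⟨A y.1, hAU y.1 y.2⟩) y (u y.1)) :=
  isFutureDirected_mfderiv_comp_of_deviation Kb U Φ hΦ hA hAU Q hOfut y (u y.1) hQ hA0 hbil hc hdev

end Certify

/-- Registered one-line form (stub `flow_reach_rechart` of the crux item) of
`flow_reach_of_certified`. [folklore] -/
theorem flow_reach_rechart : open Literature.Geometry.Lorentzian Set Topology Manifold in ∀ {𝓢 : Spacetime 4} (Kb : ModelBackground) (F : E4 → ℝ → E4) (u : E4 → E4), (∀ y : E4, ContDiff ℝ ((⊤ : ℕ∞) : WithTop ℕ∞) (F y)) → (∀ (y : E4) (σ : ℝ), HasDerivAt (F y) (u (F y σ)) σ) → (∀ y : E4, F y 0 = y) → ∀ (hdom : ∀ y : E4, y ∈ Kb.domain → ∀ σ : ℝ, F y σ ∈ Kb.domain), (∀ (y : E4) (σ : ℝ), Kb.time (F y σ) = Kb.time y + σ) → (∀ (y : E4) (σ : ℝ), Kb.radius (F y σ) = Kb.radius y) → ∀ (ψ : Kb.domain → 𝓢.carrier), ContMDiff 𝓘(ℝ, E4) (𝓡 4) ((⊤ : ℕ∞) : WithTop ℕ∞)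 ψ → ∀ (R : ℝ → ℝ), Monotone R → ∀ {r₁ S₀ : ℝ}, (∀ z : Kb.domain, S₀ ≤ Kb.time z.1 → r₁ ≤ Kb.radius z.1 → Kb.radius z.1 ≤ R (Kb.time z.1) → 𝓢.timeOrientation.IsFutureDirected (mfderiv 𝓘(ℝ, E4) (𝓡 4) ψ z (u z.1))) → ∀ (y : Kb.domain) (τ₁ : ℝ), S₀ ≤ Kb.time y.1 → Kb.time y.1 ≤ τ₁ → r₁ ≤ Kb.radius y.1 → Kb.radius y.1 ≤ R (Kb.time y.1) → ψ y ∈ 𝓢.metric.causalPast 𝓢.timeOrientation (ψ '' Kb.truncTimeSlab (R τ₁) τ₁) :=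
  fun Kb F u hF hFu hF0 hdom htime hrad ψ hψ R hRm _ _ hKO ↦
    flow_reach_of_certified Kb F u hF hFu hF0 hdom htime hrad ψ hψ R hRm hKO

end Summit.FinalStateConjecture.FinalStateConjecture.Theorems
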